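import Literature.NumberTheory.GaloisRepresentations.LocalFieldInertiaCdOne
import Literature.NumberTheory.GaloisRepresentations.LocalBrauerRestrictionDegree
import Literature.NumberTheory.GaloisRepresentations.KummerTwo
import HarnessLib

/-!
# `cd_p(Gal(F̄/F_∞)) ≤ 1` along a tower of `p`-divisible degree (Serre, *Cohomologie galoisienne* II §3.3 Prop. 9)

Topic `NumberTheory/GaloisRepresentations`; namespace `Literature.NumberTheory.GaloisRepresentations`.
Theorems only (no definition, no named fact; D-0026).

Let `F` be a non-archimedean local field of characteristic `0`, `Γ_F = Gal(F̄/F)`, `p` a prime.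
Serre II §3.3 Prop. 9 (= Harari, *Galois cohomology and class field theory*, Thm. 8.11 (a)): **if
`L/F` is an algebraic extension with `p^∞ ∣ [L : F]`, then `cd_p(Gal(F̄/L)) ≤ 1`**.  We prove it for
`L = F_∞ = ⋃ₖ F_k` the union of a tower cut out by a decreasing sequence of open subgroups
`S_k ≤ Γ_F` in which the `p`-part of the degree grows without bound above every finite extension:

* `groupCdLE_one_of_forall_subsingleton_two_mu_inf` — **abstract criterion** (any field `F` of
  characteristic `0`): a closed subgroup `N ≤ Γ_F` with `H²(Gal(F̄/E) ∩ N, μ_p) = 0` for every finite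
  `E/F` has `cd_p(N) ≤ 1`.  This is the
  argument of the tree's `groupCdLE_one_galUnr` (`LocalFieldInertiaCdOne`, the case `N = Gal(F̄/F^nr)`)
  run for an arbitrary closed `N`: every open subgroup of `N` is a trace `N ∩ Gal(F̄/E)`
  (`exists_eq_subgroupOf_of_isOpen_of_isClosed`); Sylow descent to an open subgroup acting through a
  `p`-group (`subsingleton_of_isOpen_of_index_coprime`, `subsingleton_two_of_pGroup_quotient`) reduces
  `H²(N, B) = 0` (`B` finite `p`-primary) to trivial `B` of order `p`, which is `μ_p` over the
  cyclotomic subgroup (`exists_galFixing_cyclotomic`); then Serre I §3.1 Prop. 11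
  (`groupCdLE_one_of_forall_subsingleton_two`, `subsingleton_of_forall_finite`).
* `subsingleton_two_mu_inf_iInf_of_tower`, `groupCdLE_one_iInf_of_tower` — **the tower**: for
  `S : ℕ → Subgroup Γ_F` antitone and open such that for every open `A ≤ Γ_F` and every `k` there is
  `k' ≥ k` with `p ∣ (A ∩ S_k : A ∩ S_{k'})`, one has `H²(Gal(F̄/E) ∩ ⋂ₖ S_k, μ_p) = 0` for all finite
  `E` — every class of `H²` of the intersection comes from a finite stage `Gal(F̄/E_k) = Gal(F̄/E) ∩ S_k`
  (`exists_resSub_eq_of_iInf`, `ProfiniteIntersectionCocycleExtension`) and dies in `E_{k'}` since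
  `p ∣ [E_{k'} : E_k]` (`resSub_two_mu_eq_zero_of_dvd_relIndex`, `LocalBrauerRestrictionDegree`:
  `Br(E_k)[p]` is split by every extension of degree divisible by `p`) — hence
  **`cd_p(⋂ₖ S_k) ≤ 1`**.

The `ℤ_p`-tower of a non-trivial continuous `φ : Γ_F → ℤ_p` (`S_k = φ⁻¹(p^k ℤ_p)`,
`⋂ₖ S_k = ker φ`) is treated in `LocalZpTowerCdOne`.

## References
* J.-P. Serre, *Cohomologie galoisienne* / *Galois Cohomology* (1997), II §3.3 Prop. 9; II §4.3
  Prop. 12; I §3.1 Prop. 11; I §3.3 Cor. 1. [SerreGaloisCohomology1997]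
* D. Harari, *Galois Cohomology and Class Field Theory* (2020), Thm. 8.11 (a). [Harari2020]
* J.-P. Serre, *Corps locaux* (1968), XIII §3. [SerreLocalFields1979]
-/

noncomputable section

open CategoryTheory Function
open Field IsNonarchimedeanLocalField ValuativeRel IntermediateField

universe u

namespace Literature.NumberTheory.GaloisRepresentations

open _root_.TopRep _root_.ContRepresentation _root_.ContinuousCohomology DiscreteGaloisModule
open _root_.Topology _root_.Filter
open LocalWeilDatum GaloisRepresentations.IsNonarchimedeanLocalField

section AnyField

variable (F : Type u) [Field F]

/-! ### Open subgroups of a closed subgroup `N ≤ Γ_F` -/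

/-- **Every open subgroup of a closed `N ≤ Γ_F` is `N ∩ Gal(F̄/E)` for a finite `E/F`** (an open
subgroup `H'` of `N` contains `N ∩ Gal(F̄/L₀)` for a finite Galois `L₀`; the open subgroup
`H' · Gal(F̄/L₀)` of `Γ_F` is `Gal(F̄/E)` for a finite `E`, and meets `N` in `H'` by the modular law).
The case `N = Gal(F̄/F^nr)` is the tree's `exists_eq_subgroupOf_of_isOpen` (private helper: Krull's
correspondence for open subgroups). [folklore] -/
private theorem exists_eq_subgroupOf_of_isOpen_of_isClosed (N : Subgroup (absoluteGaloisGroup F))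
    (H' : Subgroup N) (hH' : IsOpen (H' : Set N)) :
    ∃ E : IntermediateField F (AlgebraicClosure F), FiniteDimensional F E ∧
      H'.map N.subtype = galFixing F E ⊓ N := by
  classical
  -- `N ∩ Gal(F̄/L₀) ≤ H'` for a finite Galois `L₀`
  obtain ⟨V, hV, hVH⟩ := (mem_nhds_subtype _ (1 : N) (H' : Set N)).1 (hH'.mem_nhds H'.one_mem)
  obtain ⟨L₀, hfin, hgal, hL₀⟩ := exists_finiteDimensional_isGalois_galFixing_subset (k := F) hV
  haveI := hfin
  haveI := hgal
  haveI : (galFixing F L₀).Normal := normal_galFixing L₀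
  set H'' : Subgroup (absoluteGaloisGroup F) := H'.map N.subtype with hH''def
  have hH''N : H'' ≤ N := Subgroup.map_subtype_le H'
  -- the open subgroup `T = H'' Gal(F̄/L₀)` of `Γ_F` is `Gal(F̄/E)`
  set T : Subgroup (absoluteGaloisGroup F) := H'' ⊔ galFixing F L₀ with hTdef
  have hkerT : (resGal L₀).ker ≤ T := by rw [ker_resGal]; exact le_sup_right
  set E : IntermediateField F (AlgebraicClosure F) := lift (fixedField (T.map (resGal L₀))) with hEdef
  have hTE : galFixing F E = T := by
    rw [hEdef, galFixing_lift_fixedField, Subgroup.comap_map_eq_self hkerT]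
  haveI : FiniteDimensional F E := (liftAlgEquiv (fixedField (T.map (resGal L₀)))).toLinearEquiv.finiteDimensional
  refine ⟨E, inferInstance, ?_⟩
  rw [hTE]
  apply le_antisymm
  · exact le_inf le_sup_left hH''N
  · intro x hx
    obtain ⟨hxT, hxN⟩ := Subgroup.mem_inf.1 hx
    have hxT' : (x : absoluteGaloisGroup F) ∈ ((T : Subgroup (absoluteGaloisGroup F)) : Set (absoluteGaloisGroup F)) := hxT
    rw [hTdef, Subgroup.mul_normal] at hxT'
    obtain ⟨h, hh, g, hg, rfl⟩ := Set.mem_mul.1 hxT'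
    -- `g = h⁻¹ x ∈ N ∩ Gal(F̄/L₀) ≤ H''`
    have hgN : g ∈ N := by
      have := N.mul_mem (N.inv_mem (hH''N hh)) hxN
      rwa [inv_mul_cancel_left] at this
    have hgH' : (⟨g, hgN⟩ : N) ∈ H' := hVH (show ((⟨g, hgN⟩ : N) : absoluteGaloisGroup F) ∈ V from hL₀ hg)
    have hgH'' : g ∈ H'' := ⟨⟨g, hgN⟩, hgH', rfl⟩
    exact H''.mul_mem hh hgH''

/-! ### The abstract criterion: `H²(Gal(F̄/E) ∩ N, μ_p) = 0` for all finite `E` gives `cd_p(N) ≤ 1` -/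

/-- **`H²(H', μ_p) = 0` for every open subgroup `H'` of a closed `N ≤ Γ_F`** with
`H²(Gal(F̄/E) ∩ N, μ_p) = 0` for all finite `E/F`.
[cite: SerreGaloisCohomology1997, II §4.3 Prop. 12 (proof)] -/
theorem subsingleton_two_mu_of_isOpen_of_forall {p : ℕ} (N : Subgroup (absoluteGaloisGroup F))
    [IsClosed (N : Set (absoluteGaloisGroup F))]
    (hN : ∀ (E : IntermediateField F (AlgebraicClosure F)) [FiniteDimensional F E],
      Subsingleton (continuousCohomology 2 ((mu F p).restrict (subgroupIncl (galFixing F E ⊓ N))).toTopRep))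
    (H' : Subgroup N) (hH' : IsOpen (H' : Set N)) :
    Subsingleton (continuousCohomology 2
      (((mu F p).restrict (subgroupIncl N)).restrict (subgroupIncl H')).toTopRep) := by
  obtain ⟨E, hfin, hE⟩ := exists_eq_subgroupOf_of_isOpen_of_isClosed F N H' hH'
  haveI := hfin
  have hle : galFixing F E ⊓ N ≤ N := inf_le_right
  have hH'eq : H' = (galFixing F E ⊓ N).subgroupOf N := by
    rw [← hE]
    exact (Subgroup.comap_map_eq_self_of_injective N.subtype_injective H').symm
  have s1 := hN E
  rw [hH'eq]
  exact (subsingleton_iff_of_continuousMulEquiv (Subgroup.subgroupOfContinuousMulEquivOfLe hle)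
    ((mu F p).restrict (subgroupIncl (galFixing F E ⊓ N)))
    (((mu F p).restrict (subgroupIncl N)).restrict
      (subgroupIncl ((galFixing F E ⊓ N).subgroupOf N))) (fun _ _ => rfl) 2).1 s1

variable [CharZero F]

/-- **`H²(H, W) = 0` for every open `H ≤ N` and every trivial `H`-module `W` of prime order `p`**
(`N ≤ Γ_F` closed with `H²(Gal(F̄/E) ∩ N, μ_p) = 0` for all finite `E`): over
`H' = H ∩ Gal(F̄/F(ζ_p))` (index dividing `p - 1`) `W ≅ μ_p`, and `H²(H', μ_p) = 0`
(`subsingleton_two_mu_of_isOpen_of_forall`).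
[cite: SerreGaloisCohomology1997, II §3.1 Prop. 5 (proof), II §4.3 Prop. 12] -/
theorem subsingleton_two_of_trivial_card_prime_of_forall {p : ℕ} [hp : Fact p.Prime]
    (N : Subgroup (absoluteGaloisGroup F)) [IsClosed (N : Set (absoluteGaloisGroup F))]
    (hN : ∀ (E : IntermediateField F (AlgebraicClosure F)) [FiniteDimensional F E],
      Subsingleton (continuousCohomology 2 ((mu F p).restrict (subgroupIncl (galFixing F E ⊓ N))).toTopRep))
    (H : Subgroup N) (hH : IsOpen (H : Set N))
    (W : Type u) [AddCommGroup W] [TopologicalSpace W] [DiscreteTopology W] [Finite W]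
    (σ : ContinuousRep H ℤ W) (htriv : ∀ (g : H) (w : W), σ g w = w) (hcard : Nat.card W = p) :
    Subsingleton (continuousCohomology 2 σ.toTopRep) := by
  classical
  haveI := absoluteGaloisGroup_compactSpace F
  haveI : IsClosed (H : Set N) := Subgroup.isClosed_of_isOpen H hH
  haveI : NeZero ((p : ℕ) : F) := NeZero.charZero
  haveI : NeZero p := ⟨hp.out.ne_zero⟩
  haveI := AlgebraicClosure.hasEnoughRootsOfUnity F p
  obtain ⟨S₀, hS₀n, hS₀o, hS₀c, hS₀fix⟩ := exists_galFixing_cyclotomic (k := F) (p := p)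
  haveI := hS₀n
  -- the cyclotomic subgroup pulled back to `N`
  let S₀N : Subgroup N := S₀.comap N.subtype
  haveI : S₀N.Normal := Subgroup.Normal.comap inferInstance _
  have hS₀No : IsOpen (S₀N : Set N) := hS₀o.preimage continuous_subtype_val
  have hS₀Nc : S₀N.index.Coprime p := by
    have hdvd : S₀N.index ∣ S₀.index := by
      rw [Subgroup.index_comap, Subgroup.range_subtype]
      exact Subgroup.relIndex_dvd_index_of_normal S₀ N
    exact Nat.Coprime.coprime_dvd_left hdvd hS₀c
  let H' : Subgroup N := S₀N ⊓ H
  have hH'o : IsOpen (H' : Set N) := by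
    change IsOpen ((S₀N : Set N) ∩ H)
    exact hS₀No.inter hH
  have hle : H' ≤ H := inf_le_right
  -- `H²(H', μ_p) = 0`
  have s1 := subsingleton_two_mu_of_isOpen_of_forall F N hN H' hH'o
  -- `μ_p ≅ W` over `H'` (both trivial of order `p`)
  let σ' : ContinuousRep H' ℤ W := σ.restrict (inclCMH hle)
  have hmu : ∀ (g : H') (v : MuCarrier F p),
      ((mu F p).restrict (subgroupIncl N)).restrict (subgroupIncl H') g v = v := by
    intro g v
    apply MuCarrier.toAdditive.injective
    rw [ContinuousRep.restrict_apply, subgroupIncl_apply, ContinuousRep.restrict_apply, subgroupIncl_apply,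
      mu_apply_apply]
    apply congrArg Additive.ofMul
    apply Subtype.ext
    rw [absoluteGaloisGroup.coe_smul_rootsOfUnity]
    exact hS₀fix _ g.2.1 _
  have hcmu : Nat.card (MuCarrier F p) = p := by
    change Nat.card (rootsOfUnity p (AlgebraicClosure F)) = p
    exact HasEnoughRootsOfUnity.natCard_rootsOfUnity _ p
  haveI : Finite (MuCarrier F p) := Nat.finite_of_card_ne_zero (by rw [hcmu]; exact hp.out.ne_zero)
  have s2 : Subsingleton (continuousCohomology 2 σ'.toTopRep) :=
    subsingleton_of_trivial_of_card_eq (((mu F p).restrict (subgroupIncl N)).restrict (subgroupIncl H'))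
      σ' hmu (fun g w => htriv _ w) hcmu hcard 2 s1
  -- transport to `H' ∩ H ≤ H` and up to `H` (index prime to `p`)
  have s3 : Subsingleton (continuousCohomology 2 (σ.restrict (subgroupIncl (H'.subgroupOf H))).toTopRep) :=
    (subsingleton_iff_of_continuousMulEquiv (Subgroup.subgroupOfContinuousMulEquivOfLe hle) σ'
      (σ.restrict (subgroupIncl (H'.subgroupOf H))) (fun _ _ => rfl) 2).1 s2
  have hM : IsPrimaryTorsion p W := fun w => ⟨1, by
    rw [pow_one]
    exact addOrderOf_dvd_iff_nsmul_eq_zero.1 (hcard ▸ addOrderOf_dvd_natCard w)⟩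
  have hSo : IsOpen ((H'.subgroupOf H : Subgroup H) : Set H) := by
    change IsOpen ((Subtype.val : H → N) ⁻¹' (H' : Set N))
    exact hH'o.preimage continuous_subtype_val
  have hcop : (H'.subgroupOf H).index.Coprime p := by
    change ((S₀N ⊓ H).relIndex H).Coprime p
    rw [Subgroup.inf_relIndex_right]
    exact Nat.Coprime.coprime_dvd_left (Subgroup.relIndex_dvd_index_of_normal S₀N H) hS₀Nc
  exact subsingleton_of_isOpen_of_index_coprime σ hM hSo hcop 1 s3

/-- **`H²(N, B) = 0` for every finite `p`-primary discrete `N`-module `B`** (`N ≤ Γ_F` closed with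
`H²(Gal(F̄/E) ∩ N, μ_p) = 0` for all finite `E`): `B` is trivial on an open normal `N₀ ≤ N`; with a
Sylow `p`-subgroup `P` of `N/N₀` and its preimage `H` (open, index prime to `p`) it suffices to treat
`H` (`subsingleton_of_isOpen_of_index_coprime`), which acts through the `p`-group `P`; dévissage
(`subsingleton_two_of_pGroup_quotient`) reduces to `subsingleton_two_of_trivial_card_prime_of_forall`.
[cite: SerreGaloisCohomology1997, II §4.3 Prop. 12, I §3.3 Cor. 1, II §3.1 Prop. 5 (proof)] -/
theorem subsingleton_two_of_finite_of_forall {p : ℕ} [hp : Fact p.Prime]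
    (N : Subgroup (absoluteGaloisGroup F)) [IsClosed (N : Set (absoluteGaloisGroup F))]
    (hN : ∀ (E : IntermediateField F (AlgebraicClosure F)) [FiniteDimensional F E],
      Subsingleton (continuousCohomology 2 ((mu F p).restrict (subgroupIncl (galFixing F E ⊓ N))).toTopRep))
    (B : Type u) [AddCommGroup B] [TopologicalSpace B] [DiscreteTopology B] [Finite B]
    (τ : ContinuousRep N ℤ B) (hB : IsPrimaryTorsion p B) :
    Subsingleton (continuousCohomology 2 τ.toTopRep) := by
  classical
  haveI := absoluteGaloisGroup_compactSpace F
  -- the kernel is open: an open normal subgroup `N₀` acting trivially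
  have hU : (⋂ b : B, {σ : N | τ σ b = b}) ∈ 𝓝 (1 : N) :=
    (Filter.iInter_mem).2 fun b => τ.setOf_apply_eq_mem_nhds_one b
  have h1 : (1 : N) ∈ interior (⋂ b : B, {σ : N | τ σ b = b}) :=
    mem_interior_iff_mem_nhds.2 hU
  obtain ⟨N₀, hN₀⟩ := ProfiniteGrp.exist_openNormalSubgroup_sub_open_nhds_of_one isOpen_interior h1
  have hN₀' : ∀ g ∈ (N₀ : Subgroup N), ∀ b : B, τ g b = b := fun g hg b =>
    Set.mem_iInter.1 (interior_subset (hN₀ hg)) b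
  -- Sylow `p`-subgroup of the finite quotient and its preimage `H`
  haveI : Finite (N ⧸ (N₀ : Subgroup N)) := Subgroup.quotient_finite_of_isOpen _ N₀.isOpen
  obtain ⟨P⟩ := (Sylow.nonempty : Nonempty (Sylow p (N ⧸ (N₀ : Subgroup N))))
  set H : Subgroup N := (P : Subgroup _).comap (QuotientGroup.mk' (N₀ : Subgroup N)) with hHdef
  have hN₀H : (N₀ : Subgroup N) ≤ H := by
    intro g hg
    rw [hHdef, Subgroup.mem_comap, QuotientGroup.mk'_apply, (QuotientGroup.eq_one_iff g).2 hg]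
    exact one_mem _
  have hHopen : IsOpen (H : Set N) := Subgroup.isOpen_mono hN₀H N₀.isOpen
  haveI : IsClosed (H : Set N) := Subgroup.isClosed_of_isOpen H hHopen
  have hHidx : H.index.Coprime p := by
    rw [hHdef, Subgroup.index_comap_of_surjective _ (QuotientGroup.mk'_surjective _)]
    exact ((Nat.Prime.coprime_iff_not_dvd hp.out).2 P.not_dvd_index).symm
  -- `H` acts through `P`
  let φ : H →* (P : Subgroup (N ⧸ (N₀ : Subgroup N))) :=
    ((QuotientGroup.mk' (N₀ : Subgroup N)).comp H.subtype).codRestrict _ fun h =>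
      Subgroup.mem_comap.1 h.2
  haveI : Finite (H ⧸ φ.ker) :=
    Finite.of_injective (QuotientGroup.kerLift φ) (QuotientGroup.kerLift_injective φ)
  have hQ : IsPGroup p (H ⧸ φ.ker) :=
    P.isPGroup'.of_injective (QuotientGroup.kerLift φ) (QuotientGroup.kerLift_injective φ)
  have hker : ∀ g ∈ φ.ker, ∀ b : B, (τ.restrict (subgroupIncl H)) g b = b := by
    intro g hg b
    rw [MonoidHom.mem_ker] at hg
    have h1 : QuotientGroup.mk' (N₀ : Subgroup N) (g : N) = 1 :=
      congrArg (fun x : (P : Subgroup (N ⧸ (N₀ : Subgroup N))) => (x : N ⧸ (N₀ : Subgroup N))) hg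
    have h2 : (g : N) ∈ (N₀ : Subgroup N) := by
      rwa [QuotientGroup.mk'_apply, QuotientGroup.eq_one_iff] at h1
    exact hN₀' _ h2 b
  refine subsingleton_of_isOpen_of_index_coprime τ hB hHopen hHidx 1 ?_
  exact subsingleton_two_of_pGroup_quotient φ.ker hQ
    (fun W _ _ _ _ σ hσ hW => subsingleton_two_of_trivial_card_prime_of_forall F N hN H hHopen W σ hσ hW)
    B (τ.restrict (subgroupIncl H)) hB hker

/-- **`cd_p(N) ≤ 1` for a closed `N ≤ Γ_F` with `H²(Gal(F̄/E) ∩ N, μ_p) = 0` for all finite `E/F`**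
(`F` non-archimedean local of characteristic `0`): Serre I §3.1 Prop. 11
(`groupCdLE_one_of_forall_subsingleton_two`), the reduction to finite coefficients
(`subsingleton_of_forall_finite`) and `subsingleton_two_of_finite_of_forall`.
[cite: SerreGaloisCohomology1997, II §4.3 Prop. 12 (proof), I §3.1 Prop. 11] -/
theorem groupCdLE_one_of_forall_subsingleton_two_mu_inf (p : ℕ) [hp : Fact p.Prime]
    (N : Subgroup (absoluteGaloisGroup F)) [IsClosed (N : Set (absoluteGaloisGroup F))]
    (hN : ∀ (E : IntermediateField F (AlgebraicClosure F)) [FiniteDimensional F E],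
      Subsingleton (continuousCohomology 2 ((mu F p).restrict (subgroupIncl (galFixing F E ⊓ N))).toTopRep)) :
    GroupCdLE N p 1 := by
  haveI := absoluteGaloisGroup_compactSpace F
  exact groupCdLE_one_of_forall_subsingleton_two fun M _ _ _ ρ hM =>
    subsingleton_of_forall_finite ρ hp.out.ne_zero 1
      (fun B _ _ _ _ τ hB => subsingleton_two_of_finite_of_forall F N hN B τ hB) hM

end AnyField

section Local

variable (F : Type u) [Field F] [ValuativeRel F] [TopologicalSpace F] [IsNonarchimedeanLocalField F]
  [CharZero F]

/-! ### Towers of `p`-divisible degree -/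

/-- **`H²(Gal(F̄/E) ∩ ⋂ₖ S_k, μ_p) = 0`** for every finite `E/F`, where `S : ℕ → Subgroup Γ_F` is an
antitone sequence of open subgroups such that above every open `A ≤ Γ_F` the `p`-part of the index
keeps growing (`∀ k, ∃ k' ≥ k, p ∣ (A ∩ S_k : A ∩ S_{k'})`): every class of `H²` of the intersection
comes from a finite stage `Gal(F̄/E_k) = Gal(F̄/E) ∩ S_k` (`exists_resSub_eq_of_iInf`), and
`H²(Gal(F̄/E_k), μ_p)` dies on `Gal(F̄/E_{k'})` as soon as `p ∣ [E_{k'} : E_k]`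
(`resSub_two_mu_eq_zero_of_dvd_relIndex`).
[cite: SerreGaloisCohomology1997, II §3.3 Prop. 9, I §2.2 Prop. 8] [cite: SerreLocalFields1979, XIII §3 Cor. 3] -/
theorem subsingleton_two_mu_inf_iInf_of_tower {p : ℕ} [hp : Fact p.Prime]
    (S : ℕ → Subgroup (absoluteGaloisGroup F)) (hS : Antitone S)
    (hSo : ∀ k, IsOpen ((S k : Subgroup (absoluteGaloisGroup F)) : Set (absoluteGaloisGroup F)))
    (hdiv : ∀ A : Subgroup (absoluteGaloisGroup F), IsOpen (A : Set (absoluteGaloisGroup F)) →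
      ∀ k, ∃ k', k ≤ k' ∧ p ∣ (A ⊓ S k').relIndex (A ⊓ S k))
    (E : IntermediateField F (AlgebraicClosure F)) [FiniteDimensional F E] :
    Subsingleton (continuousCohomology 2
      ((mu F p).restrict (subgroupIncl (galFixing F E ⊓ ⨅ k, S k))).toTopRep) := by
  classical
  haveI : NeZero p := ⟨hp.out.ne_zero⟩
  haveI : NeZero ((p : ℕ) : F) := NeZero.charZero
  have hcmu : Nat.card (MuCarrier F p) = p := by
    change Nat.card (rootsOfUnity p (AlgebraicClosure F)) = p
    exact HasEnoughRootsOfUnity.natCard_rootsOfUnity _ p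
  haveI : Finite (MuCarrier F p) := Nat.finite_of_card_ne_zero (by rw [hcmu]; exact hp.out.ne_zero)
  -- the finite stages `Gal(F̄/E_k) = Gal(F̄/E) ∩ S_k`
  have hstage : ∀ k, ∃ Ek : IntermediateField F (AlgebraicClosure F), FiniteDimensional F Ek ∧
      galFixing F Ek = galFixing F E ⊓ S k := fun k =>
    exists_galFixing_eq_of_isOpen _ ((isOpen_galFixing F E).inter (hSo k))
  choose Ef hEfin hEf using hstage
  have hanti : Antitone fun k => galFixing F (Ef k) := fun k k' hkk' => by
    change galFixing F (Ef k') ≤ galFixing F (Ef k)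
    rw [hEf, hEf]
    exact inf_le_inf_left _ (hS hkk')
  have heq : galFixing F E ⊓ (⨅ k, S k) = ⨅ k, galFixing F (Ef k) := by
    rw [inf_iInf]
    exact iInf_congr fun k => (hEf k).symm
  rw [heq]
  refine subsingleton_two_iInf_of_forall_exists_resSub_eq_zero (mu F p) _ hanti
    (fun k => isClosed_galFixing F _) fun k y => ?_
  haveI := hEfin k
  obtain ⟨k', hkk', hdvd⟩ := hdiv (galFixing F E) (isOpen_galFixing F E) k
  haveI := hEfin k'
  rw [← hEf, ← hEf] at hdvd
  have hle : Ef k ≤ Ef k' := le_of_galFixing_le F (hanti hkk')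
  exact ⟨k', hkk', resSub_two_mu_eq_zero_of_dvd_relIndex F (Ef k) (Ef k') hle hp.out.pos hdvd y⟩

/-- **`cd_p(⋂ₖ S_k) ≤ 1`** for an antitone sequence of open subgroups `S_k ≤ Γ_F` above which the
`p`-part of the degree grows without bound over every finite extension (`F` non-archimedean local of
characteristic `0`): Serre II §3.3 Prop. 9 "`p^∞ ∣ [L : F] ⇒ cd_p(G_L) ≤ 1`" for the tower
`F_∞ = ⋃ₖ F_k`, `Gal(F̄/F_k) = S_k`.  [cite: SerreGaloisCohomology1997, II §3.3 Prop. 9]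
[cite: Harari2020, Thm. 8.11 (a)] -/
theorem groupCdLE_one_iInf_of_tower (p : ℕ) [hp : Fact p.Prime]
    (S : ℕ → Subgroup (absoluteGaloisGroup F)) (hS : Antitone S)
    (hSo : ∀ k, IsOpen ((S k : Subgroup (absoluteGaloisGroup F)) : Set (absoluteGaloisGroup F)))
    (hdiv : ∀ A : Subgroup (absoluteGaloisGroup F), IsOpen (A : Set (absoluteGaloisGroup F)) →
      ∀ k, ∃ k', k ≤ k' ∧ p ∣ (A ⊓ S k').relIndex (A ⊓ S k)) :
    GroupCdLE (⨅ k, S k : Subgroup (absoluteGaloisGroup F)) p 1 := by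
  haveI : IsClosed (((⨅ k, S k : Subgroup (absoluteGaloisGroup F))) : Set (absoluteGaloisGroup F)) := by
    rw [Subgroup.coe_iInf]
    exact isClosed_iInter fun k => Subgroup.isClosed_of_isOpen _ (hSo k)
  exact groupCdLE_one_of_forall_subsingleton_two_mu_inf F p (⨅ k, S k) fun E _ =>
    subsingleton_two_mu_inf_iInf_of_tower F S hS hSo hdiv E

end Local

end Literature.NumberTheory.GaloisRepresentations

end
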